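import Mathlib
import HarnessLib
import Summits.Ventures.LatticeQCDFlow.Scaling.MetricTunnelling
import Summits.Ventures.LatticeQCDFlow.Scaling.FluxTunnelling
import Summits.Ventures.LatticeQCDFlow.Scaling.TransformedTunnelling

/-!
# LatticeQCDFlow / Scaling — TUNNELLING LAWS V (lattice instances): the field-transformed small-step law for `U(1)` and `SU(N)`

HONEST FRAMING: exact (Metropolis-corrected) sampling algorithms for lattice gauge theory;
figures of merit are autocorrelation/cost numbers at stated couplings and volumes; no
continuum-physics claim.

THEORY-2.md §3.3 / §5 (v4.5, theory seat GEN-26, item 118).  Instances of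
`Scaling/TransformedTunnelling.lean` (the small-step tunnelling law through a `Λ`-Lipschitz field
transformation `F`, reported chain `conjKernel κ F`):

* `cthickening_anti_subset_planeCollar` — `cthickening s {∃ plane plaquette = -1} ⊆ planeCollar (4s)`
  (`0 ≤ s`; the plaquette map is `4`-Lipschitz for the sup chordal metric);
* **`conjKernel_topCharge_ne_le_of_lipschitz`** — `U(1)^E`, plane flux charge `Q`: for EVERY s-finite
  `m̃`, every `m̃`-invariant Markov kernel `κ` with a.s. `ρ`-small moves (`0 ≤ ρ`) and every
  `Λ`-Lipschitz measurable bijection `F`: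
  `((F_*m̃) ⊗ₘ conjKernel κ F){Q ≠ Q'} ≤ 2·(F_*m̃)(planeCollar (4Λρ))` — the tree's
  `FluxTunnelling.compProd_topCharge_ne_le_of_dist_le` (`2·m(planeCollar (4ρ))`) with the collar widened
  by `Λ`; for an exact reported chain `F_*m̃ = μ_β` and the right side is the one-plaquette cut tail of
  `μ_β` at width `4Λρ` (THEORY-2.md §3.3 (x) for the numbers);
* **`SUN.compProd_sector_apply_ne_le_of_lipschitz`** — `SU(N)^E` at constant one, EVERY defect set `D`
  (Lüscher's non-admissible set included), latent-side form: `≤ 2·m̃(F⁻¹ cthickening (Λρ) D)`.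

Everything here is NEW WORK of the cell (elementary given the tree); nothing is cited as a fact.
-/

noncomputable section

/-! ## §5. Lattice instances -/

namespace Summit.Ventures.LatticeQCDFlow.Theory2.Lattice.Flux

open MeasureTheory ProbabilityTheory Metric Set
open scoped ENNReal NNReal
open Literature.MathematicalPhysics.QuantumFieldTheory
open Summit.Ventures.LatticeQCDFlow.Theory2.Tunnelling
open Summit.Ventures.LatticeQCDFlow.Theory2.Tunnelling.Transformed
open Summit.Ventures.LatticeQCDFlow.Exactness

variable {d L : ℕ} [NeZero L]

/-- The chordal cut distance `‖U_p + 1‖` of one plaquette is dominated by `4·dist` to ANY configuration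
whose plaquette `p` is anti-aligned. [folklore] -/
theorem norm_plaquette_add_one_le_four_mul_dist (U V : GaugeConfig d L Circle) (x : Site d L) (μ ν : Fin d)
    (hV : plaquetteHolonomy V x μ ν = -1) :
    ‖((plaquetteHolonomy U x μ ν : Circle) : ℂ) + 1‖ ≤ 4 * dist U V := by
  have hd := dist_plaquetteHolonomy_le U V x μ ν
  rw [hV, U1.dist_eq_norm_coe, Circle.coe_neg, Circle.coe_one, sub_neg_eq_add] at hd
  exact hd

/-- **Closed thickenings of the anti-aligned set lie in plane collars**:
`cthickening s {U | ∃ plane plaquette = -1} ⊆ planeCollar (4s)` for `0 ≤ s`. [folklore] -/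
theorem cthickening_anti_subset_planeCollar (x₀ : Site d L) (μ ν : Fin d) {s : ℝ} (hs : 0 ≤ s) :
    cthickening s {V : GaugeConfig d L Circle |
        ∃ p : ZMod L × ZMod L, plaquetteHolonomy V (planeSite x₀ μ ν p) μ ν = -1} ⊆
      planeCollar x₀ μ ν (4 * s) := by
  intro U hU
  rw [mem_cthickening_iff] at hU
  by_contra hnot
  -- every plane plaquette of `U` is farther than `4s` from `-1`
  have hfar : ∀ p : ZMod L × ZMod L,
      4 * s < ‖((plaquetteHolonomy U (planeSite x₀ μ ν p) μ ν : Circle) : ℂ) + 1‖ := fun p =>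
    not_le.mp fun hp => hnot ⟨p, hp⟩
  -- a uniform margin: the minimum over the finitely many plane plaquettes
  obtain ⟨p₀, -, hp₀⟩ := Finset.exists_min_image Finset.univ
    (fun p : ZMod L × ZMod L => ‖((plaquetteHolonomy U (planeSite x₀ μ ν p) μ ν : Circle) : ℂ) + 1‖)
    Finset.univ_nonempty
  set m₀ := ‖((plaquetteHolonomy U (planeSite x₀ μ ν p₀) μ ν : Circle) : ℂ) + 1‖ with hm₀
  have hm₀s : 4 * s < m₀ := hfar p₀
  -- every anti-aligned `V` is at distance `≥ m₀ / 4 > s` from `U`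
  have hlow : ENNReal.ofReal (m₀ / 4) ≤ infEDist U {V : GaugeConfig d L Circle |
      ∃ p : ZMod L × ZMod L, plaquetteHolonomy V (planeSite x₀ μ ν p) μ ν = -1} := by
    refine le_infEDist.2 fun V hV => ?_
    obtain ⟨p, hp⟩ := hV
    have h4 := norm_plaquette_add_one_le_four_mul_dist U V (planeSite x₀ μ ν p) μ ν hp
    have hmin := hp₀ p (Finset.mem_univ p)
    rw [edist_dist]
    exact ENNReal.ofReal_le_ofReal (by linarith)
  have : ENNReal.ofReal (m₀ / 4) ≤ ENNReal.ofReal s := hlow.trans hU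
  have := (ENNReal.ofReal_le_ofReal_iff hs).1 this
  linarith

/-- **FIELD-TRANSFORMED SMALL-STEP LAW for the `U(1)` flux charge.**  `F` a `Λ`-Lipschitz measurable
bijection of `U(1)^E` (sup chordal metric), `κ` ANY `m̃`-invariant Markov kernel with a.s. `ρ`-small moves
(`0 ≤ ρ`).  The reported chain `conjKernel κ F`, in its stationary law `F_* m̃`, changes the plane charge with
one-step probability `≤ 2·(F_* m̃)(planeCollar (4Λρ))` — the tree's law
`compProd_topCharge_ne_le_of_dist_le` (`2·m(planeCollar (4ρ))`) with the collar widened by `Λ`. [folklore] -/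
theorem conjKernel_topCharge_ne_le_of_lipschitz (x₀ : Site d L) (μ ν : Fin d)
    (F : GaugeConfig d L Circle ≃ᵐ GaugeConfig d L Circle) {Λ : ℝ≥0} (hF : LipschitzWith Λ F)
    (m : Measure (GaugeConfig d L Circle)) [SFinite m]
    (κ : Kernel (GaugeConfig d L Circle) (GaugeConfig d L Circle)) [IsMarkovKernel κ]
    (hinv : κ.Invariant m) {ρ : ℝ} (hρ : 0 ≤ ρ) (hstep : ∀ᵐ q ∂(m ⊗ₘ κ), dist q.1 q.2 ≤ ρ) :
    ((m.map F) ⊗ₘ conjKernel κ F) {q | topCharge x₀ μ ν q.1 ≠ topCharge x₀ μ ν q.2} ≤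
      2 * (m.map F) (planeCollar x₀ μ ν (4 * (Λ * ρ))) := by
  set D : Set (GaugeConfig d L Circle) :=
    {V | ∃ p : ZMod L × ZMod L, plaquetteHolonomy V (planeSite x₀ μ ν p) μ ν = -1} with hD
  -- the plane charge is constant on the components of `Dᶜ` (plane-local sector confinement)
  have hQ : ∀ U, U ∉ D → ∀ U' ∈ connectedComponentIn Dᶜ U,
      topCharge x₀ μ ν U' = topCharge x₀ μ ν U := by
    intro U hU U' hU'
    haveI : PreconnectedSpace (connectedComponentIn Dᶜ U) :=
      Subtype.preconnectedSpace isPreconnected_connectedComponentIn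
    have key := topCharge_comp_eq_of_preconnected_plane
      (T := fun W : connectedComponentIn Dᶜ U => (W : GaugeConfig d L Circle)) continuous_subtype_val
      x₀ μ ν (fun W p hp => connectedComponentIn_subset _ _ W.2 ⟨p, hp⟩)
      ⟨U', hU'⟩ ⟨U, mem_connectedComponentIn hU⟩
    exact key
  have h := conjKernel_comp_ne_le_of_lipschitz (measurable_topCharge x₀ μ ν) hQ F hF
    exists_localPath_gaugeConfig_circle' m κ hinv hstep
  refine h.trans ?_
  gcongr 2 * ?_
  exact measure_mono (cthickening_anti_subset_planeCollar x₀ μ ν (mul_nonneg Λ.coe_nonneg hρ))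
  where
  /-- `(ρ, ρ)`-local paths on `U(1)^E` in the two-radius format. [folklore] -/
  exists_localPath_gaugeConfig_circle' : ∀ U U' : GaugeConfig d L Circle, dist U U' ≤ ρ →
      ∃ γ : ℝ → GaugeConfig d L Circle, ContinuousOn γ (Icc (0 : ℝ) 1) ∧ γ 0 = U ∧ γ 1 = U' ∧
        ∀ t ∈ Icc (0 : ℝ) 1, dist (γ t) U ≤ ρ := fun U U' hUU' => by
    obtain ⟨γ, hγc, hγ0, hγ1, hγd⟩ := exists_localPath_gaugeConfig_circle U U'
    exact ⟨γ, hγc, hγ0, hγ1, fun t ht => (hγd t ht).trans hUU'⟩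

end Summit.Ventures.LatticeQCDFlow.Theory2.Lattice.Flux

namespace Summit.Ventures.LatticeQCDFlow.Theory2.Lattice.SUN

open MeasureTheory ProbabilityTheory Metric Set
open scoped ENNReal NNReal Matrix.Norms.Frobenius
open Summit.Ventures.LatticeQCDFlow.Theory2.Tunnelling
open Summit.Ventures.LatticeQCDFlow.Theory2.Tunnelling.Transformed

variable {N : ℕ}

/-- **`SU(N)` FIELD-TRANSFORMED INTRINSIC LAW, constant one** (latent-side form; by
`Transformed.compProd_map_conjKernel` the left side is the reported chain's sector-change frequency in
its stationary law `F_* m̃` whenever that event is measurable).  There is `r₀ > 0` (depending on `N`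
only) such that for all `ρ ≤ r₀`, EVERY defect set `D ⊆ SU(N)^E`, every `Λ`-Lipschitz map `F` of
`SU(N)^E` (sup–Hilbert–Schmidt metric), every s-finite `m̃` and every `m̃`-invariant Markov kernel with
a.s. `ρ`-small moves: the physical sector (component of `Dᶜ`; Lüscher's topological sectors for
`D = {∃p, s_p ≥ ε_N}`) of the reported field changes with stationary one-step probability
`≤ 2·m̃(F⁻¹ cthickening (Λρ) D)` — the mass, under the reported law, of the physical collar of radius
`Λρ`. [folklore] -/
theorem compProd_sector_apply_ne_le_of_lipschitz {E : Type*} [Fintype E] : ∃ r₀ : ℝ, 0 < r₀ ∧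
    ∀ ρ : ℝ, ρ ≤ r₀ →
    ∀ (D : Set (E → Matrix.specialUnitaryGroup (Fin N) ℂ))
      (F : (E → Matrix.specialUnitaryGroup (Fin N) ℂ) → (E → Matrix.specialUnitaryGroup (Fin N) ℂ))
      (Λ : ℝ≥0), LipschitzWith Λ F →
      ∀ (m : Measure (E → Matrix.specialUnitaryGroup (Fin N) ℂ)) [SFinite m]
        (κ : Kernel (E → Matrix.specialUnitaryGroup (Fin N) ℂ) (E → Matrix.specialUnitaryGroup (Fin N) ℂ))
        [IsMarkovKernel κ], κ.Invariant m → (∀ᵐ q ∂(m ⊗ₘ κ), dist q.1 q.2 ≤ ρ) →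
        (m ⊗ₘ κ) {q | connectedComponentIn Dᶜ (F q.1) ≠ connectedComponentIn Dᶜ (F q.2)} ≤
          2 * m (F ⁻¹' cthickening (Λ * ρ) D) := by
  obtain ⟨r₀, hr₀, hpath⟩ := exists_localPaths_config (N := N) (E := E)
  refine ⟨r₀, hr₀, fun ρ hρ D F Λ hF m _ κ _ hinv hstep => ?_⟩
  calc (m ⊗ₘ κ) {q | connectedComponentIn Dᶜ (F q.1) ≠ connectedComponentIn Dᶜ (F q.2)}
      ≤ 2 * m (cthickening ρ (F ⁻¹' D)) :=
        compProd_sector_apply_ne_le_two_mul_cthickening_preimage hF.continuous (hpath ρ hρ) m κ hinv hstep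
    _ ≤ 2 * m (F ⁻¹' cthickening (Λ * ρ) D) := by
        gcongr 2 * ?_; exact measure_cthickening_preimage_le m hF D ρ

end Summit.Ventures.LatticeQCDFlow.Theory2.Lattice.SUN

end
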